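import Summits.CriticalPhenomena.CardyFormulaZ2.Theses.CardyUSTContinuation
import Summits.CriticalPhenomena.CardyFormulaZ2.Theorems.CardyUSTContinuationUniformAnalyticExtensionStubRatioToCrux
import Summits.CriticalPhenomena.CardyFormulaZ2.Theorems.CardyUSTContinuationUniformAnalyticExtensionStubSchottky
import Literature.Probability.LatticeModels.FKTwoArcPartitionPolynomials
import HarnessLib

/-!
# The Schottky reduction of the crux `UniformAnalyticExtension` (stmt-CriticalPhenomena-6047, route `CardyUSTContinuation`)

Supports file of the line `registered` (skeleton v6, lead c4).  Write `S = [t₁, 1] ⊂ ℂ`,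
`U_ρ = Metric.thickening ρ S`, `Z_δ = fkTwoArcPartitionPolynomials R δ .joint`,
`N_δ = fkTwoArcCrossingPolynomial R δ .joint` (both `ℕ[X]`, `N_δ ≤ Z_δ` coefficientwise;
`u_R(t, δ) = N_δ(t)/Z_δ(t)` for `δ, t > 0` by the Literature reduction
`measureReal_fkDomainMeasure_discreteCrossing`) and `N^c_δ = Z_δ − N_δ` (the non-crossing polynomial).

**Theorem** (`schottkyReduction_crux_of_zeroFree`).  The crux `UniformAnalyticExtension` follows from the
three δ-uniform ZERO-FREE statements (all quantified `∀ R, ∀ t₁ ∈ (0,1), ∃ ρ > 0, ∀ᶠ δ → 0⁺, ∀ z ∈ U_ρ`):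
`Z_δ(z) ≠ 0`, `N_δ(z) ≠ 0`, `N_δ(z) ≠ Z_δ(z)`.

Proof: on `U_ρ` the witness `u_δ = N_δ/Z_δ` is holomorphic and OMITS the two values `0` and `1`; every
`z ∈ U_{ρ/2}` is within `ρ/2` of a real `t ∈ S`, `ball t ρ ⊆ U_ρ`, and at the centre `u_δ(t) ∈ [0, 1]`
(`schottkyReduction_norm_ratio_ofReal_le_one`); **Schottky's theorem** (landed stub `stub_schottky`,
proved in the tree from the universal covering `λ : ℍ → ℂ ∖ {0,1}`) bounds `‖u_δ(z)‖` by the universal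
constant `C(1, 1/2)`; this is the normal form `ratioBound` on `U_{ρ/2}`
(`schottkyReduction_ratioBound_of_zeroFree`), which implies the crux (landed stub `stub_ratioToCrux`,
p145290).  So the "normality half" of the crux (the δ-uniform bound off the real axis) is not an independent
statement: modulo Schottky it is zero-freeness of the event-restricted partition functions `N_δ`, `N^c_δ`,
and ALL remaining content of the crux is of Lee–Yang type.  Möbius-invariant form: it suffices that three
distinct members of the pencil `{a N_δ + b Z_δ}` be δ-uniformly zero-free near the segment.  Every statement
is inlined (no `def`). [folklore]
-/

noncomputable section

open Filter Topology Set Polynomial Metric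
open Literature.Probability.LatticeModels
open Literature.Probability.RandomPlanarGeometry (ConformalRectangle)

namespace Summit.CriticalPhenomena.CardyFormulaZ2.Cruxes.UniformAnalyticExtension.Birth

/-- For a polynomial with natural coefficients dominated coefficientwise by another, the values at a
nonnegative real point compare the same way. [folklore] -/
theorem schottkyReduction_aeval_le_aeval_of_coeff_le {P Q : ℕ[X]} (h : ∀ n, P.coeff n ≤ Q.coeff n) {t : ℝ}
    (ht : 0 ≤ t) : aeval t P ≤ aeval t Q := by
  have hP : P.natDegree < max P.natDegree Q.natDegree + 1 := Nat.lt_succ_of_le (le_max_left _ _)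
  have hQ : Q.natDegree < max P.natDegree Q.natDegree + 1 := Nat.lt_succ_of_le (le_max_right _ _)
  rw [aeval_eq_sum_range' hP, aeval_eq_sum_range' hQ]
  refine Finset.sum_le_sum fun n _ => ?_
  simp only [nsmul_eq_mul]
  exact mul_le_mul_of_nonneg_right (Nat.cast_le.2 (h n)) (pow_nonneg ht _)

/-- At a real point `t > 0` (and `δ > 0`) the complex crossing ratio is a probability: its norm is
at most `1`. [folklore] -/
theorem schottkyReduction_norm_ratio_ofReal_le_one (R : ConformalRectangle) {δ : ℝ} (hδ : 0 < δ) {t : ℝ}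
    (ht : 0 < t) :
    ‖aeval (t : ℂ) (fkTwoArcCrossingPolynomial R δ ArcWiring.joint) /
        aeval (t : ℂ) (fkTwoArcPartitionPolynomials R δ ArcWiring.joint)‖ ≤ 1 := by
  have hZ := ratioToCrux_aeval_partition_pos R hδ ht ArcWiring.joint
  have hN0 : 0 ≤ aeval t (fkTwoArcCrossingPolynomial R δ ArcWiring.joint) := by
    have := schottkyReduction_aeval_le_aeval_of_coeff_le (P := 0) (Q := fkTwoArcCrossingPolynomial R δ ArcWiring.joint)
      (fun n => by simp) ht.le
    simpa using this
  have hNZ : aeval t (fkTwoArcCrossingPolynomial R δ ArcWiring.joint) ≤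
      aeval t (fkTwoArcPartitionPolynomials R δ ArcWiring.joint) :=
    schottkyReduction_aeval_le_aeval_of_coeff_le (coeff_fkTwoArcCrossingPolynomial_le R ArcWiring.joint) ht.le
  rw [← ratioToCrux_ofReal_aeval_natPoly, ← ratioToCrux_ofReal_aeval_natPoly, ← Complex.ofReal_div,
    Complex.norm_real, Real.norm_eq_abs, abs_of_nonneg (div_nonneg hN0 hZ.le)]
  exact (div_le_one hZ).2 hNZ

/-- **Zero-freeness of `Z_δ, N_δ, N^c_δ` ⇒ the normal form `ratioBound`** with `ρ' = ρ/2` and the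
universal Schottky bound `M = C(1, 1/2)`. [folklore] -/
theorem schottkyReduction_ratioBound_of_zeroFree :
    (∀ R : ConformalRectangle, ∀ t₁ ∈ Set.Ioo (0:ℝ) 1, ∃ ρ > (0:ℝ), ∀ᶠ δ in 𝓝[>] (0:ℝ),
      ∀ z ∈ thickening ρ (((↑) : ℝ → ℂ) '' Set.Icc t₁ 1),
        aeval z (fkTwoArcPartitionPolynomials R δ ArcWiring.joint) ≠ 0) →
    (∀ R : ConformalRectangle, ∀ t₁ ∈ Set.Ioo (0:ℝ) 1, ∃ ρ > (0:ℝ), ∀ᶠ δ in 𝓝[>] (0:ℝ),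
      ∀ z ∈ thickening ρ (((↑) : ℝ → ℂ) '' Set.Icc t₁ 1),
        aeval z (fkTwoArcCrossingPolynomial R δ ArcWiring.joint) ≠ 0) →
    (∀ R : ConformalRectangle, ∀ t₁ ∈ Set.Ioo (0:ℝ) 1, ∃ ρ > (0:ℝ), ∀ᶠ δ in 𝓝[>] (0:ℝ),
      ∀ z ∈ thickening ρ (((↑) : ℝ → ℂ) '' Set.Icc t₁ 1),
        aeval z (fkTwoArcCrossingPolynomial R δ ArcWiring.joint) ≠
          aeval z (fkTwoArcPartitionPolynomials R δ ArcWiring.joint)) →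
    (∀ R : ConformalRectangle, ∀ t₁ ∈ Set.Ioo (0:ℝ) 1, ∃ ρ > (0:ℝ), ∃ M : ℝ, ∀ᶠ δ in 𝓝[>] (0:ℝ),
      ∀ z ∈ thickening ρ (((↑) : ℝ → ℂ) '' Set.Icc t₁ 1),
        ‖aeval z (fkTwoArcCrossingPolynomial R δ ArcWiring.joint) /
            aeval z (fkTwoArcPartitionPolynomials R δ ArcWiring.joint)‖ ≤ M) := by
  intro hZ hN hNc R t₁ ht₁
  obtain ⟨C, hC⟩ := stub_schottky 1 (1 / 2) (by norm_num)
  obtain ⟨ρ₁, hρ₁, h₁⟩ := hZ R t₁ ht₁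
  obtain ⟨ρ₂, hρ₂, h₂⟩ := hN R t₁ ht₁
  obtain ⟨ρ₃, hρ₃, h₃⟩ := hNc R t₁ ht₁
  set ρ := min ρ₁ (min ρ₂ ρ₃) with hρdef
  have hρ : 0 < ρ := lt_min hρ₁ (lt_min hρ₂ hρ₃)
  refine ⟨ρ / 2, by positivity, C, ?_⟩
  filter_upwards [h₁, h₂, h₃, self_mem_nhdsWithin] with δ h₁δ h₂δ h₃δ hδ
  have hδ' : (0:ℝ) < δ := hδ
  set S : Set ℂ := ((↑) : ℝ → ℂ) '' Set.Icc t₁ 1 with hSdef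
  set N := fkTwoArcCrossingPolynomial R δ ArcWiring.joint with hNdef
  set Z := fkTwoArcPartitionPolynomials R δ ArcWiring.joint with hZdef
  intro z hz
  obtain ⟨_, ⟨t, ht, rfl⟩, hzt⟩ := mem_thickening_iff.1 hz
  have ht0 : 0 < t := ht₁.1.trans_le ht.1
  -- the disc `ball t ρ` lies in all three zero-free neighbourhoods
  have hball : ∀ {ρ' : ℝ}, ρ ≤ ρ' → ball (t : ℂ) ρ ⊆ thickening ρ' S := fun hle w hw =>
    thickening_mono hle S (mem_thickening_iff.2 ⟨t, ⟨t, ht, rfl⟩, mem_ball.1 hw⟩)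
  have hB₁ : ball (t : ℂ) ρ ⊆ thickening ρ₁ S := hball (min_le_left _ _)
  have hB₂ : ball (t : ℂ) ρ ⊆ thickening ρ₂ S := hball ((min_le_right _ _).trans (min_le_left _ _))
  have hB₃ : ball (t : ℂ) ρ ⊆ thickening ρ₃ S := hball ((min_le_right _ _).trans (min_le_right _ _))
  set f : ℂ → ℂ := fun w => aeval w N / aeval w Z with hfdef
  have hfd : DifferentiableOn ℂ f (ball (t : ℂ) ρ) := fun w hw =>
    (((Polynomial.differentiable_aeval N) w).div ((Polynomial.differentiable_aeval Z) w)
      (h₁δ w (hB₁ hw))).differentiableWithinAt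
  have hf0 : ∀ w ∈ ball (t : ℂ) ρ, f w ≠ 0 := fun w hw =>
    div_ne_zero (h₂δ w (hB₂ hw)) (h₁δ w (hB₁ hw))
  have hf1 : ∀ w ∈ ball (t : ℂ) ρ, f w ≠ 1 := fun w hw h => by
    have hZw := h₁δ w (hB₁ hw)
    exact h₃δ w (hB₃ hw) ((div_eq_one_iff_eq hZw).1 h)
  have hft : ‖f t‖ ≤ 1 := schottkyReduction_norm_ratio_ofReal_le_one R hδ' ht0
  exact hC f t ρ hρ hfd hf0 hf1 hft z (by linarith [hzt.le])


/-- **The Schottky reduction**: δ-uniform zero-freeness of `Z^joint_δ`, `N_δ` and `N^c_δ = Z_δ − N_δ` on a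
complex neighbourhood of `[t₁, 1]` (for every `R`, `t₁`) implies the crux `UniformAnalyticExtension`.
[folklore] -/
theorem schottkyReduction_crux_of_zeroFree :
    (∀ R : ConformalRectangle, ∀ t₁ ∈ Set.Ioo (0:ℝ) 1, ∃ ρ > (0:ℝ), ∀ᶠ δ in 𝓝[>] (0:ℝ),
      ∀ z ∈ thickening ρ (((↑) : ℝ → ℂ) '' Set.Icc t₁ 1),
        aeval z (fkTwoArcPartitionPolynomials R δ ArcWiring.joint) ≠ 0) →
    (∀ R : ConformalRectangle, ∀ t₁ ∈ Set.Ioo (0:ℝ) 1, ∃ ρ > (0:ℝ), ∀ᶠ δ in 𝓝[>] (0:ℝ),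
      ∀ z ∈ thickening ρ (((↑) : ℝ → ℂ) '' Set.Icc t₁ 1),
        aeval z (fkTwoArcCrossingPolynomial R δ ArcWiring.joint) ≠ 0) →
    (∀ R : ConformalRectangle, ∀ t₁ ∈ Set.Ioo (0:ℝ) 1, ∃ ρ > (0:ℝ), ∀ᶠ δ in 𝓝[>] (0:ℝ),
      ∀ z ∈ thickening ρ (((↑) : ℝ → ℂ) '' Set.Icc t₁ 1),
        aeval z (fkTwoArcCrossingPolynomial R δ ArcWiring.joint) ≠
          aeval z (fkTwoArcPartitionPolynomials R δ ArcWiring.joint)) →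
      Summit.CriticalPhenomena.CardyFormulaZ2.Theses.CardyUSTContinuation.UniformAnalyticExtension :=
  fun hZ hN hNc => stub_ratioToCrux (schottkyReduction_ratioBound_of_zeroFree hZ hN hNc)

end Summit.CriticalPhenomena.CardyFormulaZ2.Cruxes.UniformAnalyticExtension.Birth
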